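import Summits.HodgeConjecture.HodgeCM.Literature.OMeara661Step_1

/-! PORT of `HodgeCM/Literature/OMeara661Step.lean` (HodgeCMPerL run 82) — part 2: continuation of `Summits.HodgeConjecture.HodgeCM.Literature.OMeara661Step_1` (split at a top-level declaration boundary by port_pkg.py; scope re-opened below; declarations unchanged). -/

-- port_pkg: scope re-opened for this part (file-level context, then the namespace/section stack open at the cut)
set_option autoImplicit false
noncomputable section
open NumberField IsDedekindDomain Filter Topology
open Literature.NumberTheory.QuadraticForms Literature.NumberTheory.GaloisRepresentations
namespace HodgeCM.Literature.OMeara661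
/-- **O'Meara 66:1, step 5)**: if 66:1 holds for regular diagonal spaces of dimension `m + 2 ≥ 4` over the
number field `F`, it holds in dimension `m + 3`.  See the module docstring for the proof (weak approximation). -/
theorem isotropic_step {F : Type} [Field F] [NumberField F] {m : ℕ} (hm : 2 ≤ m)
    (IH : ∀ c' : Fin (m + 2) → F, (∀ i, c' i ≠ 0) →
      (∀ v : InfinitePlace F, DiagIsotropic (fun i => algebraMap F v.Completion (c' i))) →
      (∀ v : HeightOneSpectrum (𝓞 F), DiagIsotropic (fun i => algebraMap F (v.adicCompletion F) (c' i))) →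
      DiagIsotropic c')
    (c : Fin (m + 3) → F) (hc : ∀ i, c i ≠ 0)
    (hinf : ∀ v : InfinitePlace F, DiagIsotropic (fun i => algebraMap F v.Completion (c i)))
    (hfin : ∀ v : HeightOneSpectrum (𝓞 F),
      DiagIsotropic (fun i => algebraMap F (v.adicCompletion F) (c i))) :
    DiagIsotropic c := by
  classical
  haveI : NeZero (2 : F) := ⟨two_ne_zero⟩
  -- `W = ⟨c₂, …⟩ : Fin (m+1) → F`, as a form in `(m - 2) + 3` variables for the finiteness lemma
  set W : Fin (m + 1) → F := fun j => c j.succ.succ with hWdef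
  have hW : ∀ j, W j ≠ 0 := fun j => hc _
  -- the exceptional finite set of finite places
  obtain ⟨k, hk⟩ : ∃ k, m + 1 = k + 3 := ⟨m - 2, by omega⟩
  have hTfin : {v : HeightOneSpectrum (𝓞 F) |
      ¬ DiagIsotropic (fun j => algebraMap F (v.adicCompletion F) (W j))}.Finite := by
    have e : Fin (k + 3) ≃ Fin (m + 1) := finCongr hk.symm
    have h := finite_setOf_not_diagIsotropic F (m := k) (fun i => W (e i)) (fun i => hW _)
    refine h.subset fun v hv => ?_
    simp only [Set.mem_setOf_eq] at hv ⊢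
    intro h'
    apply hv
    obtain ⟨x, hx0, hx⟩ := h'
    refine ⟨fun j => x (e.symm j), ?_, ?_⟩
    · intro h0
      apply hx0
      funext i
      simpa using congrFun h0 (e i)
    · rw [← Equiv.sum_comp e]
      simpa only [Equiv.symm_apply_apply] using hx
  set S : Finset (HeightOneSpectrum (𝓞 F)) := hTfin.toFinset with hSdef
  -- local data at the finite places of `S`
  have locF : ∀ v : (S : Type), ∃ ξ η μ : v.1.adicCompletion F, μ ≠ 0 ∧
      algebraMap F _ (c 0) * ξ ^ 2 + algebraMap F _ (c 1) * η ^ 2 = μ ∧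
      ∃ w : Fin (m + 1) → v.1.adicCompletion F, ∑ j, algebraMap F _ (W j) * w j ^ 2 = -μ := by
    intro v
    haveI := neZero_two_adicCompletion F v.1
    exact exists_local_value (by omega) (fun i => algebraMap F (v.1.adicCompletion F) (c i))
      (fun i => (map_ne_zero _).2 (hc i)) (hfin v.1)
  choose ξF ηF μF hμF hUF wF hWF using locF
  -- local data at the infinite places
  have locI : ∀ w : InfinitePlace F, ∃ ξ η μ : w.Completion, μ ≠ 0 ∧
      algebraMap F _ (c 0) * ξ ^ 2 + algebraMap F _ (c 1) * η ^ 2 = μ ∧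
      ∃ w' : Fin (m + 1) → w.Completion, ∑ j, algebraMap F _ (W j) * w' j ^ 2 = -μ := by
    intro w
    haveI : CharZero w.Completion := charZero_of_injective_algebraMap (algebraMap F _).injective
    haveI : NeZero (2 : w.Completion) := ⟨two_ne_zero⟩
    exact exists_local_value (by omega) (fun i => algebraMap F w.Completion (c i))
      (fun i => (map_ne_zero _).2 (hc i)) (hinf w)
  choose ξI ηI μI hμI hUI wI hWI using locI
  -- the binary form `U` as a function on pairs, in each completion
  let gF : ∀ v : (S : Type), v.1.adicCompletion F → v.1.adicCompletion F → v.1.adicCompletion F :=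
    fun v s t => algebraMap F _ (c 0) * s ^ 2 + algebraMap F _ (c 1) * t ^ 2
  let gI : ∀ w : InfinitePlace F, w.Completion → w.Completion → w.Completion :=
    fun w s t => algebraMap F _ (c 0) * s ^ 2 + algebraMap F _ (c 1) * t ^ 2
  -- the neighbourhoods in each completion
  let UF : ∀ v : (S : Type), Set (v.1.adicCompletion F) :=
    fun v => {z | Valued.v (z - μF v) < Valued.v (4 * μF v)}
  have hUF_nhds : ∀ v, UF v ∈ 𝓝 (μF v) := by
    intro v
    haveI : CharZero (v.1.adicCompletion F) :=
      charZero_of_injective_algebraMap (algebraMap F _).injective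
    have h4 : (4 : v.1.adicCompletion F) ≠ 0 := by norm_num
    have hne : Valued.v.restrict (4 * μF v) ≠ 0 := by simp [h4, hμF v]
    rw [Valued.mem_nhds]
    refine ⟨Units.mk0 _ hne, fun y hy => ?_⟩
    rw [Set.mem_setOf_eq, Units.val_mk0] at hy
    exact Valued.v.restrict_lt_iff.mp hy
  let UI : ∀ w : InfinitePlace F, Set w.Completion := fun w =>
    if hw : w.IsReal then
      {z | |InfinitePlace.Completion.ringEquivRealOfIsReal hw z -
          InfinitePlace.Completion.ringEquivRealOfIsReal hw (μI w)| <
        |InfinitePlace.Completion.ringEquivRealOfIsReal hw (μI w)|}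
    else {z | z ≠ 0}
  have hUI_nhds : ∀ w, UI w ∈ 𝓝 (μI w) := by
    intro w
    by_cases hw : w.IsReal
    · simp only [UI, dif_pos hw]
      have hcont : Continuous (InfinitePlace.Completion.ringEquivRealOfIsReal hw) :=
        (InfinitePlace.Completion.isometryEquivRealOfIsReal hw).continuous
      refine (isOpen_lt (continuous_abs.comp (hcont.sub continuous_const)) continuous_const).mem_nhds ?_
      change |InfinitePlace.Completion.ringEquivRealOfIsReal hw (μI w) -
          InfinitePlace.Completion.ringEquivRealOfIsReal hw (μI w)| <
        |InfinitePlace.Completion.ringEquivRealOfIsReal hw (μI w)|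
      rw [sub_self, abs_zero]
      exact abs_pos.2 ((map_ne_zero _).2 (hμI w))
    · simp only [UI, dif_neg hw]
      exact isOpen_ne.mem_nhds (hμI w)
  -- the product space and the target neighbourhood of the pair `((ξ_𝔭), (η_𝔭))`
  let X := (∀ v : (S : Type), v.1.adicCompletion F) × InfiniteAdeleRing F
  let p₀ : X := (fun v => ξF v, fun w => ξI w)
  let q₀ : X := (fun v => ηF v, fun w => ηI w)
  let N : Set (X × X) :=
    (⋂ v : (S : Type), {pq | gF v (pq.1.1 v) (pq.2.1 v) ∈ UF v}) ∩
      ⋂ w : InfinitePlace F, {pq | gI w (pq.1.2 w) (pq.2.2 w) ∈ UI w}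
  have hN : N ∈ 𝓝 (p₀, q₀) := by
    refine Filter.inter_mem ((Filter.iInter_mem).2 fun v => ?_) ((Filter.iInter_mem).2 fun w => ?_)
    · have hcont : Continuous fun pq : X × X => gF v (pq.1.1 v) (pq.2.1 v) := by
        have h1 : Continuous fun pq : X × X => pq.1.1 v :=
          (continuous_apply v).comp (continuous_fst.comp continuous_fst)
        have h2 : Continuous fun pq : X × X => pq.2.1 v :=
          (continuous_apply v).comp (continuous_fst.comp continuous_snd)
        exact (continuous_const.mul (h1.pow 2)).add (continuous_const.mul (h2.pow 2))
      refine hcont.continuousAt.preimage_mem_nhds ?_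
      have : gF v (p₀.1 v) (q₀.1 v) = μF v := hUF v
      rw [this]
      exact hUF_nhds v
    · have hcont : Continuous fun pq : X × X => gI w (pq.1.2 w) (pq.2.2 w) := by
        have h1 : Continuous fun pq : X × X => pq.1.2 w :=
          (continuous_apply w).comp (continuous_snd.comp continuous_fst)
        have h2 : Continuous fun pq : X × X => pq.2.2 w :=
          (continuous_apply w).comp (continuous_snd.comp continuous_snd)
        exact (continuous_const.mul (h1.pow 2)).add (continuous_const.mul (h2.pow 2))
      refine hcont.continuousAt.preimage_mem_nhds ?_
      have : gI w (p₀.2 w) (q₀.2 w) = μI w := hUI w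
      rw [this]
      exact hUI_nhds w
  -- weak approximation for the pair `(ξ, η)`
  have hdense := (denseRange_algebraMap_pi_prod (K := F) S).prodMap
    (denseRange_algebraMap_pi_prod (K := F) S)
  obtain ⟨⟨ξ, η⟩, hξη⟩ := hdense.mem_nhds hN
  obtain ⟨hξηF, hξηI⟩ := (Set.mem_inter_iff _ _ _).1 hξη
  rw [Set.mem_iInter] at hξηF hξηI
  -- the global value `μ = c₀ξ² + c₁η²`
  set μ : F := c 0 * ξ ^ 2 + c 1 * η ^ 2 with hμdef
  have hμF_mem : ∀ v : (S : Type), algebraMap F (v.1.adicCompletion F) μ ∈ UF v := by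
    intro v
    have h := hξηF v
    change gF v (algebraMap F _ ξ) (algebraMap F _ η) ∈ UF v at h
    simpa only [gF, hμdef, map_add, map_mul, map_pow] using h
  have hμI_mem : ∀ w : InfinitePlace F, algebraMap F w.Completion μ ∈ UI w := by
    intro w
    have h := hξηI w
    change gI w (algebraMap F _ ξ) (algebraMap F _ η) ∈ UI w at h
    simpa only [gI, hμdef, map_add, map_mul, map_pow] using h
  -- `μ ≠ 0`, read off at any infinite place
  have hμ0 : μ ≠ 0 := by
    obtain ⟨w⟩ := (inferInstance : Nonempty (InfinitePlace F))
    have hw := hμI_mem w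
    intro hμz
    rw [hμz, map_zero] at hw
    by_cases hwr : w.IsReal
    · simp only [UI, dif_pos hwr, Set.mem_setOf_eq, map_zero, zero_sub, abs_neg, lt_self_iff_false] at hw
    · simp only [UI, dif_neg hwr, Set.mem_setOf_eq, ne_eq, not_true_eq_false] at hw
  -- `⟨μ⟩ ⊥ W` is isotropic at every spot
  set c' : Fin (m + 2) → F := Fin.cons μ W with hc'def
  have hc' : ∀ i, c' i ≠ 0 := fun i => by
    refine Fin.cases ?_ (fun j => ?_) i
    · simpa [hc'def] using hμ0
    · simpa [hc'def] using hW j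
  have key_cons : ∀ {K : Type} [Field K] [Algebra F K],
      (fun i => algebraMap F K (c' i)) = Fin.cons (algebraMap F K μ) (fun j => algebraMap F K (W j)) := by
    intro K _ _
    funext i
    refine Fin.cases ?_ (fun j => ?_) i
    · simp [hc'def]
    · simp [hc'def]
  have hfin' : ∀ v : HeightOneSpectrum (𝓞 F),
      DiagIsotropic (fun i => algebraMap F (v.adicCompletion F) (c' i)) := by
    intro v
    rw [key_cons]
    by_cases hvS : v ∈ S
    · -- `μ ∈ μ_v F_v²`
      have hv := hμF_mem ⟨v, hvS⟩
      obtain ⟨⟨r, hr⟩, -⟩ := isSquare_div_of_valued_sub_lt F v (hμF ⟨v, hvS⟩) hv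
      refine diagIsotropic_cons_of_sq _ (μ₀ := μF ⟨v, hvS⟩) (r := r) ?_ (wF ⟨v, hvS⟩) (hWF ⟨v, hvS⟩)
      rw [sq, ← hr, mul_div_cancel₀ _ (hμF ⟨v, hvS⟩)]
    · -- `W_v` isotropic
      have hWv : DiagIsotropic (fun j => algebraMap F (v.adicCompletion F) (W j)) := by
        by_contra hno
        exact hvS (by rw [hSdef, Set.Finite.mem_toFinset]; exact hno)
      exact diagIsotropic_cons_of_isotropic _ _ hWv
  have hinf' : ∀ w : InfinitePlace F, DiagIsotropic (fun i => algebraMap F w.Completion (c' i)) := by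
    intro w
    rw [key_cons]
    have hw := hμI_mem w
    -- `μ / μ_w` is a square in `F_w`
    have hsq : IsSquare (algebraMap F w.Completion μ / μI w) := by
      by_cases hwr : w.IsReal
      · simp only [UI, dif_pos hwr, Set.mem_setOf_eq] at hw
        apply isSquare_completion_of_pos hwr
        rw [map_div₀]
        set a := InfinitePlace.Completion.ringEquivRealOfIsReal hwr (algebraMap F w.Completion μ)
        set b := InfinitePlace.Completion.ringEquivRealOfIsReal hwr (μI w)
        have hb : b ≠ 0 := (map_ne_zero _).2 (hμI w)
        have hab : 0 < a * b := by
          rcases lt_or_gt_of_ne hb with hb' | hb'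
          · rw [abs_of_neg hb'] at hw
            have : a < 0 := by have := (abs_lt.1 hw).2; linarith
            exact mul_pos_of_neg_of_neg this hb'
          · rw [abs_of_pos hb'] at hw
            have : 0 < a := by have := (abs_lt.1 hw).1; linarith
            exact mul_pos this hb'
        have : a / b = a * b / b ^ 2 := by field_simp
        rw [this]
        exact div_pos hab (by positivity)
      · exact isSquare_completion_of_isComplex (InfinitePlace.not_isReal_iff_isComplex.1 hwr) _
    obtain ⟨r, hr⟩ := hsq
    refine diagIsotropic_cons_of_sq _ (μ₀ := μI w) (r := r) ?_ (wI w) (hWI w)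
    rw [sq, ← hr, mul_div_cancel₀ _ (hμI w)]
  -- induction hypothesis and gluing
  have hV' : DiagIsotropic c' := IH c' hc' hinf' hfin'
  rw [hc'def] at hV'
  exact diagIsotropic_of_glue c ξ η μ hμ0 rfl hV'

end HodgeCM.Literature.OMeara661

end
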